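import Mathlib
import HarnessLib
import Literature.Analysis.Fourier.TitchmarshPaleyWiener
import Literature.Analysis.Fourier.PaleyWienerSchwartzBounded
import Literature.Analysis.Complex.ExpTypeIndicator
import Literature.Analysis.FluidPDE.SelfSimilar
import Literature.Analysis.FluidPDE.OseenMildUniqueness
import Literature.Analysis.UnboundedOperators.HeatKernel
import Summits.NavierStokesRegularity.NavierStokesRegularity.Theorems.LocalSineTubeDoorProfileAlignedWindowRigidityAncient

/-!
# K2 `PoloidalWindowRigidity` (stmt-NavierStokesRegularity-19708) — HORIZONTAL EXPONENTIAL TYPE ⇒ BAND-LIMITED LINE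
# RESTRICTIONS ⇒ BERNSTEIN GRADIENT BOUND (line `entire_slices`, rung `stub_expTypeTH`, steps (D) and (B) of seat ns-es-p1 g2)

Seat ns-es-p1 g2 (`--supports stmt-NavierStokesRegularity-19708 --as helper`).  One-variable complex analysis glue between
the exponential-type clause of the rung `stub_expTypeTH` (`Cruxes/PoloidalWindowRigidity/Lines/entire_slices.lean`: a uniform
Bernstein/Taylor bound `‖Dⁿ_h v(t)(y)‖ ≤ A bⁿ` of the horizontal restrictions at the points of a window) and the tree's
ONE-dimensional Paley–Wiener–Schwartz facts (`Literature.Analysis.Fourier.TitchmarshPaleyWiener`, PROVED in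
`…PaleyWienerSchwartzBounded`: `PaleyWienerSchwartz.hasFourierSupportIn_of_entire_extension`,
`PaleyWienerSchwartz.exists_entire_extension_of_hasFourierSupportIn`) — the critic's price R1 («restrict to one direction
and use the 1-D tree facts before vendoring any ℝ² Paley–Wiener–Schwartz», card §Prices) paid in that cheap form:

* `exists_entire_of_iteratedDeriv_bound` — a real-analytic `g : ℝ → ℝ` with `|g⁽ⁿ⁾(0)| ≤ A bⁿ` is the restriction of an
  entire `G` with `‖G(z)‖ ≤ A e^{b‖z‖}` (its Taylor series: radius `∞`, identity theorem on `ℝ`);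
* `hasFourierSupportIn_of_iteratedDeriv_bound` — if moreover `|g| ≤ M` on `ℝ`, then `supp ĝ ⊆ [−b/2π, b/2π]`
  (Phragmén–Lindelöf in the two half-planes, tree `Literature.Analysis.Complex.norm_le_exp_of_re_nonneg`, Boas §1.4, turns
  `A e^{b‖z‖}` + boundedness on `ℝ` into `max M A · e^{b|Im z|}`; then PWS, converse direction);
* `abs_deriv_le_of_hasFourierSupportIn` — BERNSTEIN (crude constant): `supp ĝ ⊆ [−B, B]`, `|g| ≤ M` ⇒ `|g′(0)| ≤ M e^{2πB}`
  (PWS forward direction gives the entire extension with `|G(z)| ≤ M e^{2πB|Im z|}`; Cauchy's estimate on the unit circle);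
* `hasFourierSupportIn_line_of_taylorBound` — CLASS, step (D): at a point `(t, y)` where the rung's Taylor bound holds, every
  component of the line restriction `s ↦ v(t, y + s e₀)` (`e₀ = (1,0,0)`) has Fourier support in `[−b/2π, b/2π]`;
* `norm_fderiv_apply_le_of_lineBandLimited`, `norm_fderiv_apply_le_of_lineBandLimited_typeI` — CLASS, step (B): if every
  line restriction along `e` at every negative time has Fourier support in `[−B, B]`, then
  `‖Dv(t)(y) e‖ ≤ √3 e^{2πB} sup‖v(t)‖ ≤ √3 e^{2πB} C/√(−t)` — the sub-parabolic gradient bound consumed by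
  `…SubparabolicGradient.not_backwardSingular_of_fderiv_apply_bound`.

WHAT THIS IS NOT: not a claim about Navier–Stokes regularity, not the crux, not the rung — harmonic-analysis glue
(bears_on LADDER-NS N0 via crux K2 = stmt-19708).  No summit statement is proved here.
-/

noncomputable section

-- the summit and its single sub-problem share the name (CONVENTIONS §1), as in every Theorems file
set_option linter.dupNamespace false

namespace Summit.NavierStokesRegularity.NavierStokesRegularity.Theorems.PoloidalWindowDoorPoloidalWindowRigidityLineBandLimited

open Set Function Filter MeasureTheory Metric Topology Complex
open scoped ENNReal NNReal Real Nat
open Literature.Analysis Literature.Analysis.FluidPDE Literature.Analysis.Fourier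
open Summit.NavierStokesRegularity.NavierStokesRegularity.Theorems.LocalSineTubeDoorProfileAlignedWindowRigidityAncient

/-! ### §1  Taylor bound ⇒ entire extension of exponential type -/

/-- **A real-analytic function on `ℝ` with `|g⁽ⁿ⁾(0)| ≤ A bⁿ` extends to an entire function with
`‖G(z)‖ ≤ A e^{b‖z‖}`** (the Taylor series at `0` has infinite radius; it represents `g` on all of `ℝ` by the identity
theorem; its complexification is the extension). -/
theorem exists_entire_of_iteratedDeriv_bound {g : ℝ → ℝ} (hg : AnalyticOnNhd ℝ g univ) {A b : ℝ} (hb : 0 ≤ b)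
    (hA : ∀ n : ℕ, |iteratedDeriv n g 0| ≤ A * b ^ n) :
    ∃ G : ℂ → ℂ, Differentiable ℂ G ∧ (∀ x : ℝ, G x = g x) ∧ ∀ z : ℂ, ‖G z‖ ≤ A * Real.exp (b * ‖z‖) := by
  -- Taylor coefficients `c n = g⁽ⁿ⁾(0)/n!`, `|c n| ≤ A bⁿ/n!`
  set c : ℕ → ℝ := fun n => iteratedDeriv n g 0 / n ! with hc
  have hcn : ∀ n, |c n| ≤ A * b ^ n / n ! := fun n => by
    rw [hc]; dsimp only; rw [abs_div, Nat.abs_cast]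
    exact div_le_div_of_nonneg_right (hA n) (by positivity)
  have hbd : ∀ (r : ℝ≥0) (n : ℕ), |c n| * (r : ℝ) ^ n ≤ A * Real.exp (b * r) := by
    intro r n
    have hA0 : 0 ≤ A := by
      have h := hA 0
      rw [pow_zero, mul_one] at h
      exact (abs_nonneg _).trans h
    calc |c n| * (r : ℝ) ^ n ≤ A * b ^ n / n ! * (r : ℝ) ^ n := by gcongr; exact hcn n
      _ = A * ((b * r) ^ n / n !) := by rw [mul_pow]; ring
      _ ≤ A * Real.exp (b * r) := by gcongr; exact Real.pow_div_factorial_le_exp _ (by positivity) n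
  -- the real and the complex Taylor series, both of infinite radius
  set p : FormalMultilinearSeries ℝ ℝ ℝ := FormalMultilinearSeries.ofScalars ℝ c with hp
  set P : FormalMultilinearSeries ℂ ℂ ℂ := FormalMultilinearSeries.ofScalars ℂ (fun n => (c n : ℂ)) with hP
  have hprad : p.radius = ⊤ := by
    refine ENNReal.eq_top_of_forall_nnreal_le fun r => p.le_radius_of_bound (A * Real.exp (b * r)) fun n => ?_
    rw [hp, FormalMultilinearSeries.ofScalars_norm, Real.norm_eq_abs]; exact hbd r n
  have hPrad : P.radius = ⊤ := by
    refine ENNReal.eq_top_of_forall_nnreal_le fun r => P.le_radius_of_bound (A * Real.exp (b * r)) fun n => ?_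
    rw [hP, FormalMultilinearSeries.ofScalars_norm, Complex.norm_real, Real.norm_eq_abs]; exact hbd r n
  have hpball : HasFPowerSeriesOnBall p.sum p 0 ⊤ := by
    have h := p.hasFPowerSeriesOnBall (by rw [hprad]; exact ENNReal.zero_lt_top)
    rwa [hprad] at h
  have hPball : HasFPowerSeriesOnBall P.sum P 0 ⊤ := by
    have h := P.hasFPowerSeriesOnBall (by rw [hPrad]; exact ENNReal.zero_lt_top)
    rwa [hPrad] at h
  -- `g = p.sum` on `ℝ`: same jets at `0` (hence same power series), identity theorem
  have hgp : ∀ x : ℝ, g x = p.sum x := by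
    obtain ⟨q, r, hr⟩ := hg 0 (mem_univ 0)
    have hq_eq : q = p := by
      funext n
      have h1 := hr.factorial_smul 1 n
      rw [← iteratedDeriv_eq_iteratedFDeriv, nsmul_eq_mul] at h1
      have h2 : q n (fun _ => (1 : ℝ)) = c n := by
        rw [hc]; dsimp only
        rw [eq_div_iff (Nat.cast_ne_zero.2 (Nat.factorial_ne_zero n)), mul_comm]
        exact h1
      have h3 : p n (fun _ => (1 : ℝ)) = c n := by
        rw [hp, FormalMultilinearSeries.ofScalars_apply_eq]; simp
      calc q n = ContinuousMultilinearMap.mkPiRing ℝ (Fin n) (q n fun _ => 1) :=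
            (ContinuousMultilinearMap.mkPiRing_apply_one_eq_self (q n)).symm
        _ = ContinuousMultilinearMap.mkPiRing ℝ (Fin n) (p n fun _ => 1) := by rw [h2, h3]
        _ = p n := ContinuousMultilinearMap.mkPiRing_apply_one_eq_self (p n)
    have hgq : HasFPowerSeriesAt g p 0 := hq_eq ▸ ⟨r, hr⟩
    have hdiff : HasFPowerSeriesAt (g - p.sum) (0 : FormalMultilinearSeries ℝ ℝ ℝ) 0 := by
      simpa using hgq.sub hpball.hasFPowerSeriesAt
    have hev : g =ᶠ[𝓝 (0 : ℝ)] p.sum :=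
      hdiff.eventually_eq_zero.mono fun x hx => sub_eq_zero.1 (by simpa using hx)
    have hpan : AnalyticOnNhd ℝ p.sum univ := fun x _ =>
      hpball.analyticAt_of_mem (by simp)
    exact fun x => hg.eqOn_of_preconnected_of_eventuallyEq hpan isPreconnected_univ (mem_univ 0) hev (mem_univ x)
  -- the sums written out
  have hPsum : ∀ z : ℂ, P.sum z = ∑' n, (c n : ℂ) • z ^ n := fun z => by
    rw [← FormalMultilinearSeries.ofScalars_sum_eq]; rfl
  have hpsum : ∀ x : ℝ, p.sum x = ∑' n, c n • x ^ n := fun x => by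
    rw [← FormalMultilinearSeries.ofScalars_sum_eq]; rfl
  refine ⟨P.sum, fun z => (hPball.analyticAt_of_mem (by simp)).differentiableAt,
    fun x => ?_, fun z => ?_⟩
  · -- real restriction
    rw [hgp x, hPsum, hpsum, Complex.ofReal_tsum]
    refine tsum_congr fun n => ?_
    simp only [smul_eq_mul, Complex.ofReal_mul, Complex.ofReal_pow]
  · -- growth
    rw [hPsum]
    have hle : ∀ n, ‖(c n : ℂ) • z ^ n‖ ≤ A * ((b * ‖z‖) ^ n / n !) := fun n => by
      rw [norm_smul, Complex.norm_real, norm_pow, Real.norm_eq_abs]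
      calc |c n| * ‖z‖ ^ n ≤ A * b ^ n / n ! * ‖z‖ ^ n := by gcongr; exact hcn n
        _ = A * ((b * ‖z‖) ^ n / n !) := by rw [mul_pow]; ring
    have hsum : Summable fun n => A * ((b * ‖z‖) ^ n / n !) := (Real.summable_pow_div_factorial _).mul_left A
    have hsn : Summable fun n => ‖(c n : ℂ) • z ^ n‖ := Summable.of_nonneg_of_le (fun n => norm_nonneg _) hle hsum
    have hexp : Real.exp (b * ‖z‖) = ∑' n : ℕ, (b * ‖z‖) ^ n / n ! := by
      rw [Real.exp_eq_exp_ℝ, NormedSpace.exp_eq_tsum_div]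
    calc ‖∑' n, (c n : ℂ) • z ^ n‖ ≤ ∑' n, ‖(c n : ℂ) • z ^ n‖ := norm_tsum_le_tsum_norm hsn
      _ ≤ ∑' n, A * ((b * ‖z‖) ^ n / n !) := hsn.tsum_le_tsum hle hsum
      _ = A * Real.exp (b * ‖z‖) := by rw [tsum_mul_left, hexp]

/-! ### §2  … plus boundedness on `ℝ` ⇒ band-limited (Phragmén–Lindelöf + Paley–Wiener–Schwartz) -/

/-- **Exponential type `b` and bounded on `ℝ` ⇒ Fourier support in `[−b/2π, b/2π]`.**  For a real-analytic
`g : ℝ → ℝ` with `|g⁽ⁿ⁾(0)| ≤ A bⁿ` and `|g| ≤ M` on `ℝ`, the distributional Fourier transform of `g` is supported in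
`[−b/(2π), b/(2π)]` (tree PL `Literature.Analysis.Complex.norm_le_exp_of_re_nonneg` on both half-planes, then the PROVED
converse Paley–Wiener–Schwartz direction `PaleyWienerSchwartz.hasFourierSupportIn_of_entire_extension`). -/
theorem hasFourierSupportIn_of_iteratedDeriv_bound {g : ℝ → ℝ} (hg : AnalyticOnNhd ℝ g univ) {A b M : ℝ}
    (hb : 0 ≤ b) (hA : ∀ n : ℕ, |iteratedDeriv n g 0| ≤ A * b ^ n) (hM : ∀ x : ℝ, |g x| ≤ M) :
    HasFourierSupportIn (fun s : ℝ => ((g s : ℝ) : ℂ)) (Icc (-(b / (2 * π))) (b / (2 * π))) := by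
  obtain ⟨G, hGd, hGx, hGb⟩ := exists_entire_of_iteratedDeriv_bound hg hb hA
  -- Phragmén–Lindelöf in the right and in the left half-plane
  have hre : ∀ x : ℝ, 0 ≤ x → ‖G x‖ ≤ M * Real.exp (0 * x) := fun x _ => by
    rw [zero_mul, Real.exp_zero, mul_one, hGx, Complex.norm_real, Real.norm_eq_abs]; exact hM x
  have him : ∀ y : ℝ, ‖G (y * I)‖ ≤ A * Real.exp (b * |y|) := fun y => by
    have h := hGb (y * I)
    rwa [norm_mul, Complex.norm_I, mul_one, Complex.norm_real, Real.norm_eq_abs] at h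
  have key : ∀ z : ℂ, ‖G z‖ ≤ max M A * Real.exp (b * |z.im|) := by
    intro z
    rcases le_total 0 z.re with hz | hz
    · have h := Complex.norm_le_exp_of_re_nonneg hGd hGb hre him hz
      rwa [zero_mul, zero_add] at h
    · have hGd' : Differentiable ℂ (fun w => G (-w)) := hGd.comp differentiable_neg
      have hGb' : ∀ w, ‖G (-w)‖ ≤ A * Real.exp (b * ‖w‖) := fun w => by simpa using hGb (-w)
      have hre' : ∀ x : ℝ, 0 ≤ x → ‖G (-(x : ℂ))‖ ≤ M * Real.exp (0 * x) := fun x _ => by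
        rw [zero_mul, Real.exp_zero, mul_one, ← Complex.ofReal_neg, hGx, Complex.norm_real, Real.norm_eq_abs]
        exact hM (-x)
      have him' : ∀ y : ℝ, ‖G (-(y * I))‖ ≤ A * Real.exp (b * |y|) := fun y => by
        have h := him (-y)
        rw [abs_neg] at h
        simpa using h
      have h := Complex.norm_le_exp_of_re_nonneg hGd' hGb' hre' him' (z := -z) (by simp; linarith)
      rw [zero_mul, zero_add, neg_neg] at h
      simpa using h
  have hB : 2 * π * (b / (2 * π)) = b := by field_simp
  exact PaleyWienerSchwartz.hasFourierSupportIn_of_entire_extension (by positivity) hGd (fun x => hGx x)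
    fun z => by rw [hB]; exact key z

/-! ### §3  Band-limited and bounded ⇒ Bernstein bound on the derivative -/

/-- **Bernstein's inequality, crude constant**: if `g : ℝ → ℝ` is continuous, `|g| ≤ M`, differentiable at `0`, and the
Fourier transform of `g` is supported in `[−B, B]`, then `|g′(0)| ≤ M e^{2πB}` (PROVED forward Paley–Wiener–Schwartz
`PaleyWienerSchwartz.exists_entire_extension_of_hasFourierSupportIn`: entire extension with `|G(z)| ≤ M e^{2πB|Im z|}`;
Cauchy's estimate on the unit circle). -/
theorem abs_deriv_le_of_hasFourierSupportIn {g : ℝ → ℝ} {g' : ℝ} (hg : HasDerivAt g g' 0) (hgc : Continuous g)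
    {M : ℝ} (hM : ∀ x : ℝ, |g x| ≤ M) {B : ℝ} (hB : 0 ≤ B)
    (hF : HasFourierSupportIn (fun s : ℝ => ((g s : ℝ) : ℂ)) (Icc (-B) B)) :
    |g'| ≤ M * Real.exp (2 * π * B) := by
  have hfc : Continuous fun s : ℝ => ((g s : ℝ) : ℂ) := Complex.continuous_ofReal.comp hgc
  have hfM : ∀ t : ℝ, ‖((g t : ℝ) : ℂ)‖ ≤ M := fun t => by
    rw [Complex.norm_real, Real.norm_eq_abs]; exact hM t
  obtain ⟨F, hFd, hFx, hFb⟩ := PaleyWienerSchwartz.exists_entire_extension_of_hasFourierSupportIn hfc hfM hB hF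
  have hM0 : 0 ≤ M := (abs_nonneg _).trans (hM 0)
  -- Cauchy on the unit circle
  have hC : ∀ z ∈ sphere (0 : ℂ) 1, ‖F z‖ ≤ M * Real.exp (2 * π * B) := by
    intro z hz
    have hz1 : ‖z‖ = 1 := mem_sphere_zero_iff_norm.1 hz
    refine (hFb z).trans (mul_le_mul_of_nonneg_left (Real.exp_le_exp.2 ?_) hM0)
    calc 2 * π * B * |z.im| ≤ 2 * π * B * 1 :=
          mul_le_mul_of_nonneg_left ((Complex.abs_im_le_norm z).trans hz1.le) (by positivity)
      _ = 2 * π * B := mul_one _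
  have hd : ‖deriv F 0‖ ≤ M * Real.exp (2 * π * B) / 1 :=
    Complex.norm_deriv_le_of_forall_mem_sphere_norm_le one_pos hFd.diffContOnCl hC
  -- the derivative of the restriction is `g'(0)`
  have h1 : HasDerivAt (fun y : ℝ => F y) (deriv F 0) 0 := by
    refine HasDerivAt.comp_ofReal ?_
    rw [Complex.ofReal_zero]
    exact (hFd 0).hasDerivAt
  have h2 : HasDerivAt (fun y : ℝ => F y) ((g' : ℝ) : ℂ) 0 :=
    hg.ofReal_comp.congr_of_eventuallyEq (Eventually.of_forall fun y => hFx y)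
  have heq : ((g' : ℝ) : ℂ) = deriv F 0 := h2.unique h1
  calc |g'| = ‖((g' : ℝ) : ℂ)‖ := by rw [Complex.norm_real, Real.norm_eq_abs]
    _ = ‖deriv F 0‖ := by rw [heq]
    _ ≤ M * Real.exp (2 * π * B) := by simpa using hd

/-! ### §4  The class: step (D) at a window point and step (B) on the slab -/

variable {v : ℝ → EuclideanSpace ℝ (Fin 3) → EuclideanSpace ℝ (Fin 3)}

/-- Bookkeeping: the line `s ↦ y + s e` is real-analytic. -/
theorem analyticAt_line (y e : EuclideanSpace ℝ (Fin 3)) (s : ℝ) :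
    AnalyticAt ℝ (fun σ : ℝ => y + σ • e) s :=
  analyticAt_const.add (analyticAt_id.smul analyticAt_const)

/-- Bookkeeping: the derivative of `s ↦ V(y + s e)` at `s₀` is `DV(y + s₀ e) e`. -/
theorem hasDerivAt_line {V : EuclideanSpace ℝ (Fin 3) → EuclideanSpace ℝ (Fin 3)} {y e : EuclideanSpace ℝ (Fin 3)}
    {s₀ : ℝ} (hV : DifferentiableAt ℝ V (y + s₀ • e)) :
    HasDerivAt (fun s : ℝ => V (y + s • e)) (fderiv ℝ V (y + s₀ • e) e) s₀ := by
  have h1 : HasDerivAt (fun s : ℝ => y + s • e) e s₀ := by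
    simpa using ((hasDerivAt_id s₀).smul_const e).const_add y
  exact hV.hasFDerivAt.comp_hasDerivAt s₀ h1

/-- **STEP (D): the rung's Taylor bound at a point makes the line restrictions band-limited.**  Let `v` be
Oseen-ancient (continuous on the open slab, bounded on every `(−∞,−δ)`, unit-viscosity Oseen-mild), `t < 0`, `y ∈ ℝ³`, and
suppose the horizontal restriction `p ↦ v(t, y + (p₀, p₁, 0))` satisfies `‖Dⁿ(·)(0)‖ ≤ A bⁿ` for all `n` (the clause of
`stub_expTypeTH` at the window point `(t, y)`).  Then for every component `i` the line restriction
`s ↦ v_i(t, y + s e₀)`, `e₀ = (1,0,0)`, has distributional Fourier support in `[−b/(2π), b/(2π)]`.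
(Restriction to the line costs nothing: `‖Dⁿ(g ∘ ℓ)(0)‖ ≤ ‖Dⁿg(0)‖‖ℓ‖ⁿ`, `‖ℓ‖ ≤ 1`; the slice is real-analytic and
bounded on `ℝ³` by the class; then §2.) -/
theorem hasFourierSupportIn_line_of_taylorBound (hcont : ContinuousOn (uncurry v) (Iio (0 : ℝ) ×ˢ univ))
    (hbdd : ∀ δ : ℝ, 0 < δ → ∃ B : ℝ, ∀ t < -δ, ∀ y : EuclideanSpace ℝ (Fin 3), ‖v t y‖ ≤ B)
    (hmild : ∀ s t : ℝ, s < t → t < 0 → ∀ y : EuclideanSpace ℝ (Fin 3),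
      v t y = UnboundedOperators.heatExtension (v s) (t - s) y - oseenDuhamel 1 s v v t y)
    {t : ℝ} (ht : t < 0) (y : EuclideanSpace ℝ (Fin 3)) {A b : ℝ} (hb : 0 ≤ b)
    (hA : ∀ n : ℕ, ‖iteratedFDeriv ℝ n (fun p : EuclideanSpace ℝ (Fin 2) =>
        v t (y + (EuclideanSpace.single 0 (p 0) + EuclideanSpace.single 1 (p 1)))) 0‖ ≤ A * b ^ n)
    (i : Fin 3) :
    HasFourierSupportIn (fun s : ℝ => ((v t (y + s • EuclideanSpace.single 0 1) i : ℝ) : ℂ))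
      (Icc (-(b / (2 * π))) (b / (2 * π))) := by
  -- the slice is real-analytic and bounded
  have hAn : AnalyticOnNhd ℝ (v t) univ := analyticOnNhd_slice hcont hbdd hmild ht
  obtain ⟨Bt, hBt⟩ := hbdd (-(t / 2)) (by linarith)
  have hBt' : ∀ x, ‖v t x‖ ≤ Bt := fun x => hBt t (by linarith) x
  set e₀ : EuclideanSpace ℝ (Fin 3) := EuclideanSpace.single 0 1 with he₀
  set g : ℝ → ℝ := fun s => v t (y + s • e₀) i with hgdef
  -- the horizontal lift `L : ℝ² → ℝ³` and the line embedding `ℓ : ℝ → ℝ²`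
  obtain ⟨L, hL⟩ : ∃ L : EuclideanSpace ℝ (Fin 2) →L[ℝ] EuclideanSpace ℝ (Fin 3),
      ∀ p, L p = EuclideanSpace.single 0 (p 0) + EuclideanSpace.single 1 (p 1) :=
    ⟨LinearMap.toContinuousLinearMap
      { toFun := fun p => EuclideanSpace.single 0 (p 0) + EuclideanSpace.single 1 (p 1)
        map_add' := fun p q => by ext j; fin_cases j <;> simp
        map_smul' := fun c p => by ext j; fin_cases j <;> simp }, fun p => rfl⟩
  set ℓ : ℝ →L[ℝ] EuclideanSpace ℝ (Fin 2) :=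
    ContinuousLinearMap.smulRight (ContinuousLinearMap.id ℝ ℝ) (EuclideanSpace.single 0 (1 : ℝ)) with hℓ
  have hℓapp : ∀ s : ℝ, ℓ s = s • EuclideanSpace.single 0 (1 : ℝ) := fun s => by simp [hℓ]
  have hLℓ : ∀ s : ℝ, y + L (ℓ s) = y + s • e₀ := by
    intro s
    rw [hℓapp, hL, he₀]
    congr 1
    ext j; fin_cases j <;> simp
  set F : EuclideanSpace ℝ (Fin 2) → EuclideanSpace ℝ (Fin 3) :=
    fun p => v t (y + (EuclideanSpace.single 0 (p 0) + EuclideanSpace.single 1 (p 1))) with hFdef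
  have hFeq : F = (v t) ∘ fun p => y + L p := by
    funext p; simp only [hFdef, comp_apply, hL]
  have hFsmooth : ContDiff ℝ (⊤ : ℕ∞) F := by
    rw [hFeq]
    exact hAn.contDiff.comp (contDiff_const.add L.contDiff)
  have hgeq : g = (EuclideanSpace.proj (𝕜 := ℝ) i) ∘ (F ∘ ℓ) := by
    funext s
    simp only [hgdef, comp_apply, hFdef]
    rw [← hL, hLℓ s]
    rfl
  -- the Taylor bound on the line
  have hℓnorm : ‖ℓ‖ ≤ 1 := by
    rw [hℓ, ContinuousLinearMap.norm_smulRight_apply, PiLp.norm_single, norm_one, mul_one]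
    exact ContinuousLinearMap.norm_id_le
  have hproj : ‖(EuclideanSpace.proj (𝕜 := ℝ) i : EuclideanSpace ℝ (Fin 3) →L[ℝ] ℝ)‖ ≤ 1 :=
    ContinuousLinearMap.opNorm_le_bound _ zero_le_one fun x => by simpa using PiLp.norm_apply_le x i
  have hAg : ∀ n : ℕ, |iteratedDeriv n g 0| ≤ A * b ^ n := by
    intro n
    have hAn0 : 0 ≤ A * b ^ n := (norm_nonneg _).trans (hA n)
    have hFℓ : ContDiff ℝ (⊤ : ℕ∞) (F ∘ ℓ) := hFsmooth.comp ℓ.contDiff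
    have h1 : iteratedFDeriv ℝ n g 0 =
        (EuclideanSpace.proj (𝕜 := ℝ) i).compContinuousMultilinearMap (iteratedFDeriv ℝ n (F ∘ ℓ) 0) := by
      rw [hgeq]
      exact ContinuousLinearMap.iteratedFDeriv_comp_left _ hFℓ.contDiffAt (by exact_mod_cast le_top)
    have h2 : iteratedFDeriv ℝ n (F ∘ ℓ) 0 = (iteratedFDeriv ℝ n F (ℓ 0)).compContinuousLinearMap fun _ => ℓ :=
      ContinuousLinearMap.iteratedFDeriv_comp_right ℓ hFsmooth 0 (by exact_mod_cast le_top)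
    rw [← Real.norm_eq_abs, ← norm_iteratedFDeriv_eq_norm_iteratedDeriv, h1, h2, map_zero]
    calc ‖(EuclideanSpace.proj (𝕜 := ℝ) i).compContinuousMultilinearMap
            ((iteratedFDeriv ℝ n F 0).compContinuousLinearMap fun _ => ℓ)‖
        ≤ ‖(EuclideanSpace.proj (𝕜 := ℝ) i : EuclideanSpace ℝ (Fin 3) →L[ℝ] ℝ)‖ *
            ‖(iteratedFDeriv ℝ n F 0).compContinuousLinearMap fun _ => ℓ‖ :=
          ContinuousLinearMap.norm_compContinuousMultilinearMap_le _ _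
      _ ≤ 1 * (‖iteratedFDeriv ℝ n F 0‖ * ∏ _j : Fin n, ‖ℓ‖) := by
          gcongr
          exact ContinuousMultilinearMap.norm_compContinuousLinearMap_le _ _
      _ ≤ 1 * (A * b ^ n * 1) := by
          gcongr
          · exact hA n
          · exact Finset.prod_le_one (fun _ _ => norm_nonneg _) fun _ _ => hℓnorm
      _ = A * b ^ n := by ring
  -- analyticity and boundedness of `g` on `ℝ`
  have hgan : AnalyticOnNhd ℝ g univ := by
    intro s _
    have h := ((EuclideanSpace.proj (𝕜 := ℝ) i : EuclideanSpace ℝ (Fin 3) →L[ℝ] ℝ).analyticAt _).comp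
      ((hAn _ (mem_univ _)).comp (analyticAt_line y e₀ s))
    exact h
  have hgM : ∀ x : ℝ, |g x| ≤ Bt := fun x => by
    have h := PiLp.norm_apply_le (v t (y + x • e₀)) i
    rw [Real.norm_eq_abs] at h
    exact h.trans (hBt' _)
  exact hasFourierSupportIn_of_iteratedDeriv_bound hgan hb hAg hgM

/-- **STEP (B): band-limited line restrictions along `e` everywhere ⇒ Bernstein bound on `Dv·e`.**  If every line
restriction `s ↦ v_i(t, y + s e)` at the negative time `t` has Fourier support in `[−B, B]` and `‖v(t,·)‖ ≤ M_t` on `ℝ³`,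
then `‖Dv(t)(y) e‖ ≤ √3 · M_t e^{2πB}` at every `y`. -/
theorem norm_fderiv_apply_le_of_lineBandLimited (hcont : ContinuousOn (uncurry v) (Iio (0 : ℝ) ×ˢ univ))
    (hbdd : ∀ δ : ℝ, 0 < δ → ∃ B : ℝ, ∀ t < -δ, ∀ y : EuclideanSpace ℝ (Fin 3), ‖v t y‖ ≤ B)
    (hmild : ∀ s t : ℝ, s < t → t < 0 → ∀ y : EuclideanSpace ℝ (Fin 3),
      v t y = UnboundedOperators.heatExtension (v s) (t - s) y - oseenDuhamel 1 s v v t y)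
    {e : EuclideanSpace ℝ (Fin 3)} {B : ℝ} (hB : 0 ≤ B) {t : ℝ} (ht : t < 0)
    (hF : ∀ (y : EuclideanSpace ℝ (Fin 3)) (i : Fin 3),
      HasFourierSupportIn (fun s : ℝ => ((v t (y + s • e) i : ℝ) : ℂ)) (Icc (-B) B))
    {Mt : ℝ} (hMt : ∀ x, ‖v t x‖ ≤ Mt) (y : EuclideanSpace ℝ (Fin 3)) :
    ‖fderiv ℝ (v t) y e‖ ≤ Real.sqrt 3 * (Mt * Real.exp (2 * π * B)) := by
  have hAn : AnalyticOnNhd ℝ (v t) univ := analyticOnNhd_slice hcont hbdd hmild ht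
  set K : ℝ := Mt * Real.exp (2 * π * B) with hK
  -- componentwise Bernstein bound
  have hcomp : ∀ i : Fin 3, |fderiv ℝ (v t) y e i| ≤ K := by
    intro i
    set g : ℝ → ℝ := fun s => v t (y + s • e) i with hgdef
    have hline : HasDerivAt (fun s : ℝ => v t (y + s • e)) (fderiv ℝ (v t) (y + (0 : ℝ) • e) e) 0 :=
      hasDerivAt_line (hAn _ (mem_univ _)).differentiableAt
    rw [zero_smul, add_zero] at hline
    have hg : HasDerivAt g (fderiv ℝ (v t) y e i) 0 :=
      ((EuclideanSpace.proj (𝕜 := ℝ) i : EuclideanSpace ℝ (Fin 3) →L[ℝ] ℝ).hasFDerivAt.comp_hasDerivAt 0 hline)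
    have hgc : Continuous g := by
      have hl : Continuous fun s : ℝ => v t (y + s • e) :=
        (continuous_slice hcont ht).comp (continuous_const.add (continuous_id.smul continuous_const))
      have h := ((EuclideanSpace.proj (𝕜 := ℝ) i : EuclideanSpace ℝ (Fin 3) →L[ℝ] ℝ).continuous.comp hl)
      exact h
    have hgM : ∀ x : ℝ, |g x| ≤ Mt := fun x => by
      have h := PiLp.norm_apply_le (v t (y + x • e)) i
      rw [Real.norm_eq_abs] at h
      exact h.trans (hMt _)
    exact abs_deriv_le_of_hasFourierSupportIn hg hgc hgM hB (hF y i)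
  -- assemble the Euclidean norm
  have hK0 : 0 ≤ K := (abs_nonneg _).trans (hcomp 0)
  rw [EuclideanSpace.norm_eq]
  calc Real.sqrt (∑ i, ‖fderiv ℝ (v t) y e i‖ ^ 2) ≤ Real.sqrt (∑ _i : Fin 3, K ^ 2) := by
        gcongr with i
        rw [Real.norm_eq_abs]
        exact hcomp i
    _ = Real.sqrt 3 * K := by
        rw [Finset.sum_const, Finset.card_univ, Fintype.card_fin, nsmul_eq_mul, Nat.cast_ofNat,
          Real.sqrt_mul (by norm_num), Real.sqrt_sq hK0]

/-- **STEP (B) for the Type-I class**: with the Type-I rate `‖v(t,x)‖ ≤ C/√(−t)`,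
`‖Dv(t)(y) e‖ ≤ (√3 e^{2πB} C)/√(−t)` — the hypothesis of `…SubparabolicGradient.not_backwardSingular_of_fderiv_apply_bound`. -/
theorem norm_fderiv_apply_le_of_lineBandLimited_typeI {C : ℝ} (hrate : HasTypeITimeDecay C v)
    (hcont : ContinuousOn (uncurry v) (Iio (0 : ℝ) ×ˢ univ))
    (hmild : ∀ s t : ℝ, s < t → t < 0 → ∀ y : EuclideanSpace ℝ (Fin 3),
      v t y = UnboundedOperators.heatExtension (v s) (t - s) y - oseenDuhamel 1 s v v t y)
    {e : EuclideanSpace ℝ (Fin 3)} {B : ℝ} (hB : 0 ≤ B)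
    (hF : ∀ t < 0, ∀ (y : EuclideanSpace ℝ (Fin 3)) (i : Fin 3),
      HasFourierSupportIn (fun s : ℝ => ((v t (y + s • e) i : ℝ) : ℂ)) (Icc (-B) B)) :
    ∀ t < 0, ∀ y : EuclideanSpace ℝ (Fin 3),
      ‖fderiv ℝ (v t) y e‖ ≤ Real.sqrt 3 * Real.exp (2 * π * B) * C / Real.sqrt (-t) := by
  intro t ht y
  have h := norm_fderiv_apply_le_of_lineBandLimited hcont (bdd_of_hasTypeITimeDecay hrate) hmild hB ht (hF t ht)
    (fun x => hrate t ht x) y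
  calc ‖fderiv ℝ (v t) y e‖ ≤ Real.sqrt 3 * (C / Real.sqrt (-t) * Real.exp (2 * π * B)) := h
    _ = Real.sqrt 3 * Real.exp (2 * π * B) * C / Real.sqrt (-t) := by ring

end Summit.NavierStokesRegularity.NavierStokesRegularity.Theorems.PoloidalWindowDoorPoloidalWindowRigidityLineBandLimited

end
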